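import Literature.NumberTheory.Sieve.LargeSieveCharacters
import Literature.Analysis.Quadrature.DigitalNetAverageDiscrepancy
import HarnessLib

/-!
# The Pólya–Vinogradov inequality for primitive characters with Landau's leading constant `2/π`

Topic `Literature/NumberTheory/Sieve` (namespace `Literature.NumberTheory.Sieve.LargeSieve`, as the
tree's `polyaVinogradov`). Everything here is PROVED (theorems only; no definition, no named fact).

The tree's Pólya–Vinogradov inequality `LargeSieve.polyaVinogradov` (`LargeSieveCharacters.lean`,
Cojocaru–Murty (8.14)) reads `|∑_{A<n≤A+N} χ(n)| ≤ √q (1 + log q)` for `χ` primitive mod `q ≥ 2`; its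
proof majorises the geometric sums `|∑_n e(bn/q)| ≤ 1/sin(πb/q)` by Jordan's inequality term by term
(`inv_norm_e_sub_one_le`, `sum_Ioo_div_add_div_le`: `∑_{0<b<q} 1/sin(πb/q) ≤ q H_{q−1}`). Replacing that
last step by the integral comparison for the CONVEX cosecant — Landau 1918, as recapitulated by
Pomerance: "`∑_{a=1}^{q−1} 1/sin(πa/q) < (q/π)∫_{π/(2q)}^{π−π/(2q)} csc t dt = (2q/π) log((1 +
cos(π/2q))/sin(π/2q)) < (2q/π)(log q + log(4/π) + π²/(12q²))`" ([Pomerance2011], proof of Lemma 4,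
(4)–(5)) — gives the classical leading constant `2/π`:

* `polyaVinogradov_two_div_pi` — **`|∑_{A<n≤A+N} χ(n)| ≤ (2/π) √q log q + (2/5) √q`** for `χ`
  primitive mod `q ≥ 2` (Landau's (2) in [Pomerance2011] §1 has the same main term `(2/π)√q log q`,
  there for all non-principal `χ` with a `log log` secondary term).

The cosecant sum is NOT re-proved: the tree already has it, by exactly this midpoint-convexity
telescoping, as `Literature.Analysis.Quadrature.sum_inv_sin_le`
(`∑_{κ=1}^{b−1} 1/sin(πκ/b) ≤ (2/π) b log b + (2/5) b`, Niederreiter's form, file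
`DigitalNetAverageDiscrepancy.lean`), which is imported and cited here. The better constants `2/π²`
(even `χ`) and `1/(2π)` (odd `χ`) of [Pomerance2011] Theorem 1 / Frolenkov–Soundararajan (the tree's
named fact `frolenkovSoundararajan2013_pv`) need the Fourier expansion of the interval indicator and are
not attempted in this file. SEQUEL (2026-08-29): `PolyaVinogradovOddCharacters.lean` (same namespace,
imports this file) carries out the Landau–Pomerance sawtooth expansion in the kernel: `polyaVinogradov_odd`
(odd `χ`: `√q log q/(2π) + √q log log q/π + (5/2)√q + 1`), `polyaVinogradov_even` (even `χ`, with the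
Fourier series of `|sin|`: `(2/π²)√q log q + (4/π²)√q log log q + 3√q + 1`) and `polyaVinogradov_one_div_pi`
(Landau's `1/π` for all primitive `χ`: `√q log q/π + 2√q log log q/π + 2√q + 1`); the Frolenkov–Soundararajan
secondary terms of the named fact remain out of reach (source not held).

## References

* C. Pomerance, *Remarks on the Pólya–Vinogradov inequality*, Integers 11 (2011) 531–542, §1 (2) and
  §2, proof of Lemma 4, (4)–(5) (held: `paper:doi-10-1515-integ-2011-039`, pp. 2, 4–5). [Pomerance2011]
* H. L. Montgomery, R. C. Vaughan, *Multiplicative Number Theory I*, CUP 2007, §9.4 Theorem 9.18.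
  [MontgomeryVaughan2007]
* A. C. Cojocaru, M. R. Murty, *An Introduction to Sieve Methods and their Applications*, CUP 2005,
  (8.14)–(8.16). [CojocaruMurty2005]
-/

noncomputable section

open Finset Real Complex

namespace Literature.NumberTheory.Sieve.LargeSieve

open DirichletCharacter

/-- **Pólya–Vinogradov with the leading constant `2/π`** (Landau 1918; [Pomerance2011] §2 (4)–(5)):
for `χ` primitive mod `q ≥ 2` and every interval `(A, A + N]`,
`|∑_{A < n ≤ A+N} χ(n)| ≤ (2/π) √q log q + (2/5) √q`. (Gauss-sum expansion `sum_inv_mul_e_eq`, the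
geometric sums `|∑_n e(bn/q)| ≤ 2/|e(b/q) − 1| = 1/sin(πb/q)`, and the cosecant sum
`Literature.Analysis.Quadrature.sum_inv_sin_le`; compare the tree's `polyaVinogradov`, `√q(1 + log q)`.)
[cite: Pomerance2011, §2 proof of Lemma 4 (4)–(5); §1 (2)] [cite: MontgomeryVaughan2007, §9.4 Thm. 9.18] -/
theorem polyaVinogradov_two_div_pi {q : ℕ} (hq : 2 ≤ q) {χ : DirichletCharacter ℂ q}
    (hχ : χ.IsPrimitive) (A N : ℕ) :
    ‖∑ n ∈ Ioc A (A + N), χ n‖ ≤ 2 / π * Real.sqrt q * Real.log q + 2 / 5 * Real.sqrt q := by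
  have : NeZero q := ⟨by omega⟩
  have hq0 : (0 : ℝ) < q := by exact_mod_cast (by omega : 0 < q)
  have hπ := Real.pi_pos
  -- Gauss sum expansion
  have hexp := gaussSum_mul_sum_mul_char hχ ((Ioc A (A + N)).map Nat.castEmbedding) (fun _ => 1)
  simp only [one_mul, sum_map, Nat.castEmbedding_apply, Int.cast_natCast] at hexp
  have hτ : ‖gaussSum χ⁻¹ ZMod.stdAddChar‖ = Real.sqrt q := by
    rw [← Real.sqrt_sq (norm_nonneg _), norm_gaussSum_sq (isPrimitive_inv hχ)]
  have hχ0 : χ⁻¹ ((0 : ℕ) : ZMod q) = 0 := by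
    haveI : Fact (1 < q) := ⟨hq⟩
    rw [Nat.cast_zero, MulChar.map_zero]
  -- each `b`-term is a geometric sum of modulus `≤ 1/sin(π b/q)`
  have hterm : ∀ b ∈ Ico 1 q, ‖χ⁻¹ b * ∑ n ∈ Ioc A (A + N), e ((b : ℝ) * (n : ℕ) / q)‖ ≤
      1 / Real.sin (π * b / q) := by
    intro b hb
    rw [mem_Ico] at hb
    obtain ⟨hb1, hbq⟩ := hb
    have hsinpos : 0 < Real.sin (π * ((b : ℝ) / q)) := by
      refine Real.sin_pos_of_pos_of_lt_pi (by positivity) ?_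
      calc π * ((b : ℝ) / q) < π * 1 := by
            gcongr; rw [div_lt_one hq0]; exact_mod_cast hbq
        _ = π := mul_one π
    have hnorm : ‖e ((b : ℝ) / q) - 1‖ = 2 * Real.sin (π * ((b : ℝ) / q)) := by
      rw [norm_e_sub_one, abs_of_pos hsinpos]
    have hne : e ((b : ℝ) / q) ≠ 1 := by
      intro h
      have h1 : ‖e ((b : ℝ) / q) - 1‖ = 0 := by rw [h, sub_self, norm_zero]
      rw [hnorm] at h1
      linarith
    have hgeom : ‖∑ n ∈ Ioc A (A + N), e ((b : ℝ) * (n : ℕ) / q)‖ ≤ 2 / ‖e ((b : ℝ) / q) - 1‖ := by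
      have := norm_sum_Ioc_e_le A N hne
      refine le_of_eq_of_le (congr_arg _ (sum_congr rfl fun n _ => ?_)) this
      congr 1; ring
    rw [norm_mul]
    calc ‖χ⁻¹ (b : ZMod q)‖ * ‖∑ n ∈ Ioc A (A + N), e ((b : ℝ) * (n : ℕ) / q)‖
        ≤ 1 * (2 / ‖e ((b : ℝ) / q) - 1‖) :=
          mul_le_mul (DirichletCharacter.norm_le_one _ _) hgeom (norm_nonneg _) zero_le_one
      _ = 1 / Real.sin (π * b / q) := by
          rw [one_mul, hnorm, mul_div_assoc, div_mul_eq_div_div]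
          norm_num
  -- assemble with the cosecant sum `∑_{0<b<q} 1/sin(πb/q) ≤ (2/π) q log q + (2/5) q`
  have hsum : ‖∑ b ∈ range q, χ⁻¹ b * ∑ n ∈ Ioc A (A + N), e ((b : ℝ) * (n : ℕ) / q)‖ ≤
      2 / π * q * Real.log q + 2 / 5 * q := by
    have hr : range q = insert 0 (Ico 1 q) := by
      ext b; simp only [mem_range, mem_insert, mem_Ico]; omega
    rw [hr, sum_insert (by simp), hχ0, zero_mul, zero_add]
    exact (norm_sum_le _ _).trans ((sum_le_sum hterm).trans
      (Literature.Analysis.Quadrature.sum_inv_sin_le hq))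
  have hfin : Real.sqrt q * ‖∑ n ∈ Ioc A (A + N), χ n‖ ≤ 2 / π * q * Real.log q + 2 / 5 * q := by
    rw [← hτ, ← norm_mul, hexp]; exact hsum
  have hsq : (0 : ℝ) < Real.sqrt q := Real.sqrt_pos.2 hq0
  have hr2 : Real.sqrt q ^ 2 = q := Real.sq_sqrt hq0.le
  have hfin' : Real.sqrt q * ‖∑ n ∈ Ioc A (A + N), χ n‖ ≤
      Real.sqrt q * (2 / π * Real.sqrt q * Real.log q + 2 / 5 * Real.sqrt q) := by
    calc Real.sqrt q * ‖∑ n ∈ Ioc A (A + N), χ n‖ ≤ 2 / π * q * Real.log q + 2 / 5 * q := hfin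
      _ = Real.sqrt q * (2 / π * Real.sqrt q * Real.log q + 2 / 5 * Real.sqrt q) := by
          linear_combination (-(2 / π * Real.log q + 2 / 5)) * hr2
  exact le_of_mul_le_mul_left hfin' hsq

/-- The same bound for an initial segment `1 ≤ n ≤ N`:
`|∑_{n ≤ N} χ(n)| ≤ (2/π) √q log q + (2/5) √q` (`χ(0) = 0` for `q ≥ 2`).
[cite: Pomerance2011, §1 (2) (Landau)] -/
theorem polyaVinogradov_two_div_pi_Icc {q : ℕ} (hq : 2 ≤ q) {χ : DirichletCharacter ℂ q}
    (hχ : χ.IsPrimitive) (N : ℕ) :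
    ‖∑ n ∈ Icc 1 N, χ n‖ ≤ 2 / π * Real.sqrt q * Real.log q + 2 / 5 * Real.sqrt q := by
  have h := polyaVinogradov_two_div_pi hq hχ 0 N
  rwa [zero_add, show Ioc 0 N = Icc 1 N from rfl] at h

end Literature.NumberTheory.Sieve.LargeSieve

end
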